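import Summits.NavierStokesRegularity.NavierStokesRegularity.Theorems.ApexLocalisation.Negative.LogicAndLoadBearing
import Literature.Analysis.FluidPDE.NSBoundedMildOseen
import Literature.Analysis.UnboundedOperators.HeatKernelHeatEquation

/-!
# `ApexLocalisation` (crux stmt-NavierStokesRegularity-11719): the PICKED line
# `decaying-ancient-bridge` — degenerate members and degenerate hull directions of its class 𝒜(C,B)
# — negative-side support (cdisprove seat, gen 3, `-- Targets`)

The lead's skeleton `Cruxes/ApexLocalisation/Lines/decaying-ancient-bridge.lean` (stubs
`stub_slabCompactness`, `stub_rateToAncient`, `stub_radiationBound`, `stub_hullSelection` (THE BET),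
`stub_hullClosed`, `stub_apexOfDecaying`, registered 2026-08-16T00:22Z) works with the class
𝒜(C,B) of "bounded decaying ancient solutions" `M : ℝ → ℝ³ → ℝ³`, INLINED in every stub:
continuous on the open slab, weakly divergence-free slices, the Oseen identity
`M t x = heatExtension (M s) (t-s) x - oseenDuhamel 1 s M M t x` (`s < t < 0`), `‖M‖ ≤ B`, the rate
`HasTypeITimeDecay C M`, and suitable-weak data `(q,H)` with `𝐈 < ⊤`. This file records, sorry-free:

* §1 `InBridgeClass C B M` — the inlined conjunction, verbatim (so `Iff.rfl` against every stub);
  **the zero field is a member** for `0 ≤ B`, `0 ≤ C` (`inBridgeClass_zero`): the non-triviality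
  guards of `stub_hullSelection` / `stub_apexOfDecaying` are load-bearing (without them the bet
  would have to produce a non-trivial hull limit of `M ≡ 0`, impossible: `hullLimit_zero_field`).
* §2 DEGENERATE HULL DIRECTIONS ARE USELESS FOR THE BET. For a field bounded by `B` on the slab,
  every slice-wise pointwise limit `N` of zoom-ins `λ_k M(t_k + λ_k² t, x_k + λ_k y)` with
  `λ_k → 0` VANISHES (`hullLimit_eq_zero_of_tendsto_zero`); for a field with the rate, every such
  limit with `t_k → -∞` (and `λ_k ≤ 1`) vanishes (`hullLimit_eq_zero_of_tendsto_atBot`). Hence a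
  NON-TRIVIAL hull limit as demanded by `stub_hullSelection` can only come from sequences with
  `λ_k ↛ 0` and `t_k ↛ -∞` (`not_tendsto_of_hullLimit_nontrivial`, `frequently_of_hullLimit_nontrivial`:
  `λ_k ≥ l₀ > 0` and `t_k ≥ T` infinitely often): modulo subsequences the bet is a
  statement about SPATIAL TRANSLATES (`‖x_k‖ → ∞` is the only non-compact direction left) of mild
  rescalings `λ ∈ [λ₀, 1]` and bounded time shifts — "follow one far core to infinity and see a
  single `K/‖y‖` core there".
* §3 POSITIVE GLUE the hull closure needs (tiny, stated for the lead): the bound `B` and the rate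
  `C` are inherited by every admissible zoom-in/translate/past-shift (`norm_hull_le`,
  `hasTypeITimeDecay_hull`) — `t_k ≤ 0` and `λ_k ≤ 1` are exactly what makes this work.

* (L)-VACUITY OF THE BET AND OF THE ⇐ TRANSFER: companion file `Negative/BridgeVacuity.lean`
  (non-trivial members of 𝒜(C,B) and the antecedent of `stub_apexOfDecaying` are Type-I
  singularities, via Albritton–Barker Thm 1.1 reverse direction WITHOUT mildness,
  Literature `localTypeISingularityExists_of_suitable_nontrivial'`).

## References

* G. Koch, N. Nadirashvili, G. Seregin, V. Šverák, Acta Math. 203 (2009), §6 (Lemma 6.1). [KNSS2009]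
* D. Albritton, T. Barker, J. Math. Fluid Mech. 21 (2019) = arXiv:1811.00502, Thm 1.1. [AlbrittonBarker2019]
* G. Seregin, Lecture notes on regularity theory for the Navier–Stokes equations (2014), Prop. 5.19.
-/

noncomputable section

open MeasureTheory TopologicalSpace Set Function Filter Topology Metric
open scoped InnerProductSpace RealInnerProductSpace ENNReal NNReal
open Literature.Analysis Literature.Analysis.FluidPDE
open Summit.NavierStokesRegularity.NavierStokesRegularity.Theses

set_option linter.dupNamespace false

namespace Summit.NavierStokesRegularity.NavierStokesRegularity.Theorems.ApexLocalisation.Negative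

/-- Physical space. -/
local notation "ℝ³" => EuclideanSpace ℝ (Fin 3)

/-- The open backward slab `(-∞,0) × ℝ³` (time first), as in the route file. -/
local notation "𝕊" => Literature.Analysis.FluidPDE.slab (EuclideanSpace ℝ (Fin 3)) (Set.Iio (0 : ℝ)) isOpen_Iio

/-! ## §1 The class 𝒜(C,B) of the picked line; the zero field is a member -/

/-- The class 𝒜(C,B) of the line `decaying-ancient-bridge`, VERBATIM the conjunction inlined in
`stub_rateToAncient` / `stub_hullSelection` / `stub_hullClosed` (lead's skeleton
`Cruxes/ApexLocalisation/Lines/decaying-ancient-bridge.lean`): continuity on the open slab, weakly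
divergence-free slices, the Oseen (KNSS-gauge) integral identity between all pairs of negative
times, the global bound `B`, the rate `C`, and suitable-weak data with `𝐈 < ⊤`. -/
def InBridgeClass (C B : ℝ) (M : ℝ → ℝ³ → ℝ³) : Prop :=
  ContinuousOn (uncurry M) (Iio (0 : ℝ) ×ˢ univ) ∧
    (∀ t < 0, IsWeaklyDivFree (M t)) ∧
    (∀ s t : ℝ, s < t → t < 0 → ∀ x : ℝ³,
      M t x = UnboundedOperators.heatExtension (M s) (t - s) x - oseenDuhamel 1 s M M t x) ∧
    (∀ t < 0, ∀ x : ℝ³, ‖M t x‖ ≤ B) ∧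
    HasTypeITimeDecay C M ∧
    (∃ (q : ℝ → ℝ³ → ℝ) (H : ℝ → ℝ³ → ℝ³ →L[ℝ] ℝ³),
      IsSuitableWeakSolutionOn 𝕊 1 0 M q ∧
      HasWeakSpatialGradientOn 𝕊 M H ∧
      typeIBound (Iio (0 : ℝ) ×ˢ univ) M q H < ⊤)

/-- The zero slice is weakly divergence free. -/
theorem isWeaklyDivFree_zero : IsWeaklyDivFree (0 : ℝ³ → ℝ³) := by
  intro θ _
  simp

/-- **The zero field is in 𝒜(C,B)** for `0 ≤ B`, `0 ≤ C` (`𝐈 = 0`; `e^{σΔ}0 = 0`, `B(0,0) = 0`).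
So the non-triviality guards of `stub_hullSelection` and `stub_apexOfDecaying` are load-bearing. -/
theorem inBridgeClass_zero {C B : ℝ} (hC : 0 ≤ C) (hB : 0 ≤ B) : InBridgeClass C B 0 := by
  -- suitable-weak data of the zero pair, from the parasitic library at `C = 0`
  -- (cf. `Negative/LinesLoadBearing.zero_isSuitableWeakSolutionOn_and_grad`)
  have hs := parasitic_isSuitableWeakSolutionOn 0
  have hg := parasitic_hasWeakSpatialGradientOn 0
  rw [parasiticVelocity_zero] at hs hg
  rw [parasiticPressure_zero] at hs
  have hG : (fun (t : ℝ) (x : ℝ³) => fderiv ℝ ((0 : ℝ → ℝ³ → ℝ³) t) x) = 0 := by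
    funext t x
    simp
  rw [hG] at hg
  refine ⟨continuous_const.continuousOn, fun t _ => isWeaklyDivFree_zero, fun s t _ _ x => ?_,
    fun t _ x => by simpa using hB, fun t _ x => ?_, ⟨0, 0, hs, hg, ?_⟩⟩
  · have h1 : UnboundedOperators.heatExtension ((0 : ℝ → ℝ³ → ℝ³) s) (t - s) = 0 :=
      UnboundedOperators.heatExtension_zero_fun (t - s)
    rw [h1, oseenDuhamel_zero_left]
    simp
  · simp only [Pi.zero_apply, norm_zero]
    positivity
  · rw [typeIBound_zero]
    exact ENNReal.zero_lt_top

/-- Hull limits of the zero field are zero (so a bet without the guard `∃ s y, M s y ≠ 0` would be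
false at `M ≡ 0`). -/
theorem hullLimit_zero_field {N : ℝ → ℝ³ → ℝ³} {xk : ℕ → ℝ³} {tk lk : ℕ → ℝ}
    (hconv : ∀ t < 0, TendstoLocallyUniformly
      (fun k (y : ℝ³) => lk k • (0 : ℝ → ℝ³ → ℝ³) (tk k + lk k ^ 2 * t) (xk k + lk k • y)) (N t) atTop) :
    ∀ t < 0, ∀ y : ℝ³, N t y = 0 := by
  intro t ht y
  have h1 := (tendstoLocallyUniformlyOn_univ.2 (hconv t ht)).tendsto_at (mem_univ y)
  simp only [Pi.zero_apply, smul_zero] at h1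
  exact tendsto_nhds_unique h1 tendsto_const_nhds

/-! ## §2 Degenerate hull directions: zoom-ins of a bounded field and far-past shifts of a rate field
have only trivial limits -/

/-- **Zoom-in limits of a BOUNDED field vanish.** If `‖M‖ ≤ B` on the slab and `λ_k → 0`
(`λ_k > 0`, `t_k ≤ 0`), then every slice-wise pointwise limit `N` of
`λ_k M(t_k + λ_k² t, x_k + λ_k y)` is zero on the slab — whatever `x_k`, `t_k` do. -/
theorem hullLimit_eq_zero_of_tendsto_zero {M N : ℝ → ℝ³ → ℝ³} {B : ℝ}
    (hB : ∀ t < 0, ∀ x : ℝ³, ‖M t x‖ ≤ B) {xk : ℕ → ℝ³} {tk lk : ℕ → ℝ}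
    (hadm : ∀ k, tk k ≤ 0 ∧ 0 < lk k) (hlk : Tendsto lk atTop (𝓝 0))
    (hconv : ∀ t < 0, ∀ y : ℝ³,
      Tendsto (fun k => lk k • M (tk k + lk k ^ 2 * t) (xk k + lk k • y)) atTop (𝓝 (N t y))) :
    ∀ t < 0, ∀ y : ℝ³, N t y = 0 := by
  intro t ht y
  have hB0 : 0 ≤ max B 0 := le_max_right _ _
  have h2 : Tendsto (fun k => lk k • M (tk k + lk k ^ 2 * t) (xk k + lk k • y)) atTop (𝓝 0) := by
    refine squeeze_zero_norm (a := fun k => |lk k| * max B 0) (fun k => ?_) ?_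
    · have htime : tk k + lk k ^ 2 * t < 0 := by
        have := (hadm k).1
        have h2 : lk k ^ 2 * t < 0 := mul_neg_of_pos_of_neg (pow_pos (hadm k).2 2) ht
        linarith
      rw [norm_smul, Real.norm_eq_abs]
      exact mul_le_mul_of_nonneg_left ((hB _ htime _).trans (le_max_left _ _)) (abs_nonneg _)
    · have : Tendsto (fun k => |lk k| * max B 0) atTop (𝓝 (|0| * max B 0)) :=
        (continuous_abs.tendsto 0 |>.comp hlk).mul_const _
      simpa using this
  exact tendsto_nhds_unique (hconv t ht y) h2

/-- **Far-past shifts of a RATE field vanish.** If `‖M(t,x)‖ ≤ C/√(−t)` and `t_k → -∞`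
(`0 < λ_k ≤ 1`), then every slice-wise pointwise limit of `λ_k M(t_k + λ_k² t, x_k + λ_k y)` is zero
on the slab: `‖λ_k M(t_k + λ_k² t, ·)‖ ≤ C/√(−t_k − λ_k² t) ≤ C/√(−t_k) → 0`. -/
theorem hullLimit_eq_zero_of_tendsto_atBot {M N : ℝ → ℝ³ → ℝ³} {C : ℝ}
    (hC : HasTypeITimeDecay C M) {xk : ℕ → ℝ³} {tk lk : ℕ → ℝ}
    (hadm : ∀ k, tk k ≤ 0 ∧ 0 < lk k ∧ lk k ≤ 1) (htk : Tendsto tk atTop atBot)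
    (hconv : ∀ t < 0, ∀ y : ℝ³,
      Tendsto (fun k => lk k • M (tk k + lk k ^ 2 * t) (xk k + lk k • y)) atTop (𝓝 (N t y))) :
    ∀ t < 0, ∀ y : ℝ³, N t y = 0 := by
  intro t ht y
  have hC0 : 0 ≤ max C 0 := le_max_right _ _
  -- eventually `tk k < 0`
  have hev : ∀ᶠ k in atTop, tk k < 0 := htk.eventually (eventually_lt_atBot 0)
  have h2 : Tendsto (fun k => lk k • M (tk k + lk k ^ 2 * t) (xk k + lk k • y)) atTop (𝓝 0) := by
    refine squeeze_zero_norm' (a := fun k => max C 0 / Real.sqrt (-tk k)) (hev.mono fun k hk => ?_) ?_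
    · have hl0 := (hadm k).2.1
      have hl1 := (hadm k).2.2
      have hneg : lk k ^ 2 * t < 0 := mul_neg_of_pos_of_neg (pow_pos hl0 2) ht
      have htime : tk k + lk k ^ 2 * t < 0 := by linarith
      have hs1 : 0 < Real.sqrt (-tk k) := Real.sqrt_pos.2 (by linarith)
      have hs2 : Real.sqrt (-tk k) ≤ Real.sqrt (-(tk k + lk k ^ 2 * t)) :=
        Real.sqrt_le_sqrt (by linarith)
      rw [norm_smul, Real.norm_of_nonneg hl0.le]
      calc lk k * ‖M (tk k + lk k ^ 2 * t) (xk k + lk k • y)‖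
          ≤ 1 * (max C 0 / Real.sqrt (-(tk k + lk k ^ 2 * t))) := by
            apply mul_le_mul hl1 _ (norm_nonneg _) zero_le_one
            exact (hC _ htime _).trans
              (div_le_div_of_nonneg_right (le_max_left _ _) (Real.sqrt_nonneg _))
        _ = max C 0 / Real.sqrt (-(tk k + lk k ^ 2 * t)) := one_mul _
        _ ≤ max C 0 / Real.sqrt (-tk k) := div_le_div_of_nonneg_left hC0 hs1 hs2
    · have hsqrt : Tendsto (fun k => Real.sqrt (-tk k)) atTop atTop :=
        Real.tendsto_sqrt_atTop.comp (tendsto_neg_atBot_atTop.comp htk)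
      exact tendsto_const_nhds.div_atTop hsqrt
  exact tendsto_nhds_unique (hconv t ht y) h2

/-- **Non-trivial hull limits need `λ_k ↛ 0` and `t_k ↛ -∞`** (for a member of 𝒜(C,B), or any
field bounded with the rate): the witnesses of `stub_hullSelection` cannot be genuine zoom-ins or
far-past shifts; modulo subsequences they are translates / mild rescalings `λ ∈ [λ₀,1]` / bounded
time shifts — the bet is a statement about where the activity goes under SPATIAL TRANSLATION. -/
theorem not_tendsto_of_hullLimit_nontrivial {M N : ℝ → ℝ³ → ℝ³} {B C : ℝ}
    (hB : ∀ t < 0, ∀ x : ℝ³, ‖M t x‖ ≤ B) (hC : HasTypeITimeDecay C M)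
    {xk : ℕ → ℝ³} {tk lk : ℕ → ℝ} (hadm : ∀ k, tk k ≤ 0 ∧ 0 < lk k ∧ lk k ≤ 1)
    (hconv : ∀ t < 0, TendstoLocallyUniformly
      (fun k (y : ℝ³) => lk k • M (tk k + lk k ^ 2 * t) (xk k + lk k • y)) (N t) atTop)
    (hN : ∃ s : ℝ, s < 0 ∧ ∃ y : ℝ³, N s y ≠ 0) :
    ¬ Tendsto lk atTop (𝓝 0) ∧ ¬ Tendsto tk atTop atBot := by
  obtain ⟨s, hs, y, hy⟩ := hN
  have hpt : ∀ t < 0, ∀ y : ℝ³,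
      Tendsto (fun k => lk k • M (tk k + lk k ^ 2 * t) (xk k + lk k • y)) atTop (𝓝 (N t y)) :=
    fun t ht y => (tendstoLocallyUniformlyOn_univ.2 (hconv t ht)).tendsto_at (mem_univ y)
  refine ⟨fun hlk => hy ?_, fun htk => hy ?_⟩
  · exact hullLimit_eq_zero_of_tendsto_zero hB (fun k => ⟨(hadm k).1, (hadm k).2.1⟩) hlk hpt s hs y
  · exact hullLimit_eq_zero_of_tendsto_atBot hC hadm htk hpt s hs y

/-- … quantitatively: along a sequence realising a NON-TRIVIAL hull limit the zoom factors exceed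
a fixed `l₀ > 0` infinitely often and the time shifts exceed a fixed level infinitely often — so a
subsequence has `λ_k → λ_∞ ∈ (0,1]` and `t_k → t_∞ ∈ (-∞,0]`, leaving the spatial translations
`x_k` as the only possibly divergent parameter of the bet's witnesses. -/
theorem frequently_of_hullLimit_nontrivial {M N : ℝ → ℝ³ → ℝ³} {B C : ℝ}
    (hB : ∀ t < 0, ∀ x : ℝ³, ‖M t x‖ ≤ B) (hC : HasTypeITimeDecay C M)
    {xk : ℕ → ℝ³} {tk lk : ℕ → ℝ} (hadm : ∀ k, tk k ≤ 0 ∧ 0 < lk k ∧ lk k ≤ 1)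
    (hconv : ∀ t < 0, TendstoLocallyUniformly
      (fun k (y : ℝ³) => lk k • M (tk k + lk k ^ 2 * t) (xk k + lk k • y)) (N t) atTop)
    (hN : ∃ s : ℝ, s < 0 ∧ ∃ y : ℝ³, N s y ≠ 0) :
    (∃ l₀ : ℝ, 0 < l₀ ∧ ∃ᶠ k in atTop, l₀ ≤ lk k) ∧ (∃ T : ℝ, ∃ᶠ k in atTop, T ≤ tk k) := by
  obtain ⟨h1, h2⟩ := not_tendsto_of_hullLimit_nontrivial hB hC hadm hconv hN
  constructor
  · by_contra hcon
    push Not at hcon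
    apply h1
    rw [Metric.tendsto_nhds]
    intro ε hε
    filter_upwards [hcon ε hε] with k hk
    rw [Real.dist_0_eq_abs, abs_of_pos (hadm k).2.1]
    exact hk
  · by_contra hcon
    push Not at hcon
    apply h2
    rw [tendsto_atBot]
    intro b
    filter_upwards [hcon b] with k hk
    exact hk.le

/-! ## §3 Positive glue for `stub_hullClosed` (the bound and the rate survive admissible hulls) -/

/-- Admissible zoom-ins/translates/past-shifts keep the bound `B` (`λ_k ≤ 1`, `B ≥ 0` forced). -/
theorem norm_hull_le {M : ℝ → ℝ³ → ℝ³} {B : ℝ} (hB : ∀ t < 0, ∀ x : ℝ³, ‖M t x‖ ≤ B)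
    {x₀ : ℝ³} {t₀ lam : ℝ} (ht₀ : t₀ ≤ 0) (hl0 : 0 < lam) (hl1 : lam ≤ 1)
    (t : ℝ) (ht : t < 0) (y : ℝ³) : ‖lam • M (t₀ + lam ^ 2 * t) (x₀ + lam • y)‖ ≤ B := by
  have hneg : lam ^ 2 * t < 0 := mul_neg_of_pos_of_neg (pow_pos hl0 2) ht
  have htime : t₀ + lam ^ 2 * t < 0 := by linarith
  have hb := hB _ htime (x₀ + lam • y)
  have hB0 : 0 ≤ B := (norm_nonneg _).trans hb
  rw [norm_smul, Real.norm_of_nonneg hl0.le]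
  calc lam * ‖M (t₀ + lam ^ 2 * t) (x₀ + lam • y)‖ ≤ 1 * B :=
        mul_le_mul hl1 hb (norm_nonneg _) zero_le_one
    _ = B := one_mul B

/-- Admissible zoom-ins/translates/past-shifts keep the RATE with the SAME constant (`t₀ ≤ 0` is
exactly what is needed: `λ C/√(−t₀ − λ²t) ≤ λ C/(λ√(−t)) = C/√(−t)`). -/
theorem hasTypeITimeDecay_hull {M : ℝ → ℝ³ → ℝ³} {C : ℝ} (hC : HasTypeITimeDecay C M)
    {x₀ : ℝ³} {t₀ lam : ℝ} (ht₀ : t₀ ≤ 0) (hl0 : 0 < lam) :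
    HasTypeITimeDecay C (fun t y => lam • M (t₀ + lam ^ 2 * t) (x₀ + lam • y)) := by
  intro t ht y
  have hneg : lam ^ 2 * t < 0 := mul_neg_of_pos_of_neg (pow_pos hl0 2) ht
  have htime : t₀ + lam ^ 2 * t < 0 := by linarith
  have hb := hC _ htime (x₀ + lam • y)
  have hC0 : 0 ≤ C := by
    have hs : 0 < Real.sqrt (-(t₀ + lam ^ 2 * t)) := Real.sqrt_pos.2 (by linarith)
    have := (norm_nonneg _).trans hb
    exact (div_nonneg_iff.1 this).elim (fun h => h.1) fun h => absurd h.2 (not_le.2 hs)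
  have hst : 0 < Real.sqrt (-t) := Real.sqrt_pos.2 (by linarith)
  have hsl : lam * Real.sqrt (-t) ≤ Real.sqrt (-(t₀ + lam ^ 2 * t)) := by
    rw [show lam * Real.sqrt (-t) = Real.sqrt (lam ^ 2 * (-t)) by
      rw [Real.sqrt_mul (sq_nonneg _), Real.sqrt_sq hl0.le]]
    exact Real.sqrt_le_sqrt (by nlinarith)
  have hpos : 0 < lam * Real.sqrt (-t) := mul_pos hl0 hst
  show ‖lam • M (t₀ + lam ^ 2 * t) (x₀ + lam • y)‖ ≤ C / Real.sqrt (-t)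
  rw [norm_smul, Real.norm_of_nonneg hl0.le]
  calc lam * ‖M (t₀ + lam ^ 2 * t) (x₀ + lam • y)‖
      ≤ lam * (C / Real.sqrt (-(t₀ + lam ^ 2 * t))) := mul_le_mul_of_nonneg_left hb hl0.le
    _ ≤ lam * (C / (lam * Real.sqrt (-t))) := by
        apply mul_le_mul_of_nonneg_left _ hl0.le
        exact div_le_div_of_nonneg_left hC0 hpos hsl
    _ = C / Real.sqrt (-t) := by
        field_simp


end Summit.NavierStokesRegularity.NavierStokesRegularity.Theorems.ApexLocalisation.Negative
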